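import Mathlib
import Literature.MathematicalPhysics.QuantumFieldTheory.Balaban1983to89.B14
import Literature.MathematicalPhysics.QuantumFieldTheory.Balaban1983to89.B16Sect1Statements

/-!
# `Balaban1983to89.B16Ineq147Chain` — T. Bałaban, *Large field renormalization. II. Localization, exponentiation,
and bounds for the 𝐑 operation*, Commun. Math. Phys. **122**, 355–392 (1989), doi:10.1007/bf01238433
[Balaban1989LargeFieldII] (cell paper B16; PDF held `paper:balaban1989-cmp122-large-field-ii`, journal page = PDF page
+ 354): THE FIRST TWO LINES OF THE CHAIN (1.47), p. 368 [PDF 14] — typed, and the passages line 1 ⇒ line 2 ⇒ line 3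
PROVED from the printed inputs, so that together with the sibling's last step (`B16Sect1Statements.ineq147_lastStep`,
r13 gen 2; count discharged in `B16Sect1BoxCounts`, gen 10) the whole display (1.47) is typed end to end and
`B16Sect1Statements.Ineq147` follows BY NAME from its first (analytic) line (mega-formalization `lit-balaban`,
reader/typer block r13, generation 12; SKELETON row B16.Eq1.47, whose cell recorded *"the first two lines of the chain —
the Γ″_j-sums with exponential decay — not typed"*).

Statement-level skeleton of published theorems with citation tags; proofs where landed; nothing here is a claim about the Yang–Mills mass gap.

THE PRINTED DISPLAY (p. 368 [14], render `1989-cmp122-large-field-II-p014-x2.png` re-read as an image by this seat),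
verbatim: *"For example, consider the most dangerous term, the term linear in 𝐇″_{h+2}. It can be bounded in the
following way:*

  *|⟨D𝐇″_{h+2}, (1/(g″_k(·))²) ζ₁η⁻² Im ∂U″_{h+2}⟩|*
  *< Σ_{j=1}^{h} Σ_{x∈Γ″_j} B₃ exp(−δd(x, Ω″^{~2}_{h+1})) O(1) L^{−N} B₃²B₅M⁶(α_{0,k} + α_{1,k}) · (1/g_k² + O(k − j)) ε_j*
  *≦ O(1)(1/g_k²)(α_{0,k} + α_{1,k}) ε_k L^{−N} N^{1+β₀} · B₃³B₅M⁶ Σ_{j=1}^{h} Σ_{x∈Γ″_j} exp(−½δd(x, Ω″^{~2}_{h+1}))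
     exp(−½δM(h − j))(1 + h − j)^{1+β₀}*
  *≦ O(1)A₀C₁B₃³B₅M⁶p₀(g_k)q₁(g_k)R_k²L^{−N}|Γ″_h ∩ Ω″^{~2}_{h+1}|*
  *≦ O(1)A₀C₁B₃³B₅M^{10}p₀(g_k)q₁(g_k)R_k⁷L^{−N}.   (1.47)*

*The last bound above is small under the usual conditions on N."*  (`h = k − N`: the `N` renormalization steps
between the scales `h` and `k`, p. 361; `Γ″_j` the `j`-th set of the generating set `𝔅″_k = {Γ″_j}` of (1.13) [IV];
`ε_j`, `α_{0,k}`, `α_{1,k}`, `p₀`, `q₁`, `R_k`, `β₀` the sequences of [III] §2 (2.2)–(2.9).)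

WHAT IS HERE (and what is an input).
* §1 TYPED: the summand and the double sum of LINE 1 (`term147a`, `rhs147a`) and the first inequality as a `Prop` on
  the value `T` of the term (`Ineq147First` — the ANALYTIC input: exponential decay of `𝐇″_{h+2}`, Theorem 1 [15]; a
  leaf, not proved here); the weight, double sum and right side of LINE 2 (`weight147`, `sum147b`, `rhs147b`); the
  right side of LINE 3 (`rhs147c`, letter for letter the left member of `B16Sect1Statements.ineq147_lastStep`).
* §2–§3 PROVED, line 1 ⇒ line 2, from exactly the inputs the printed step uses: `ε_j ≦ (1 + β₀)²(k − j)^{β₀}ε_k`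
  (the third member of (2.8) [III], SKELETON row B14.Eq2.8, `B14.FlowIneq28` + `B14FlowStep.third_members` — taken
  here in its printed shape as the hypothesis `hε`), `k − j = N + (h − j) ≦ N(1 + h − j)`, `1/g_k² + O(1)(k − j) ≦
  (1 + O(1))g_k⁻²(k − j)` for `0 < g_k ≦ 1`, and the separation `d(x, Ω″^{~2}_{h+1}) ≧ M(h − j)` for `x ∈ Γ″_j` that
  the printed factor `exp(−½δM(h − j))` asserts (hypothesis `hdist`; it is the nesting of the admissible sequence
  `{Ω″_j}` of (1.12) [IV], not re-derived here): `term147a_le`, `rhs147a_le_rhs147b`, with the explicit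
  `O(1) = C(1 + C′)(1 + β₀)²`.
* §4 PROVED, line 2 ⇒ line 3: the dictionary `g_k⁻²(α_{0,k} + α_{1,k})ε_k = A₀C₁p₀(g_k)q₁(g_k)`
  (`B16Sect1Statements.alphaEps_div_gsq` BY NAME), `N^{1+β₀} ≦ R_k²` from *"N ≦ R_k"* (p. 361,
  `B16Sect1Kernels.NWindowUpper`) and `β₀ ≦ 1`, and the printed step's implicit lattice-sum count
  *"Σ_{j=1}^{h} Σ_{x∈Γ″_j} exp(−½δd(x, Ω″^{~2}_{h+1}))exp(−½δM(h − j))(1 + h − j)^{1+β₀} ≦ O(1)|Γ″_h ∩ Ω″^{~2}_{h+1}|"* as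
  the ONE named hypothesis `hS` (`rhs147b_le_rhs147c`); §5 splits that count into a per-scale count (hypothesis
  `hcount`, geometric, not derived) and the scale sum `Σ_{j=1}^{h} exp(−½δM(h − j))(1 + h − j)^{1+β₀} ≦ 2`, PROVED for
  `δM ≧ 6`, `0 ≦ β₀ ≦ 1` (`scaleSum_le_two`, `sum147b_le_of_count`).
* §6 ASSEMBLED: `ineq147_of_first` / `ineq147_of_first_count` — `B16Sect1Statements.Ineq147` BY NAME from
  `Ineq147First` and the inputs above, through `B16Sect1Statements.ineq147_lastStep` (count `|Γ″_h ∩ Ω″^{~2}_{h+1}| ≦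
  O(1)M⁴R_k⁵`, hypothesis `hΓ` as there; `B16Sect1BoxCounts.cardΓ147_of_box` discharges it on the box carrier).
Nothing else is asserted: the first `<` of (1.47) stays the analytic leaf `Ineq147First`; the row's head stays `typed`.
-/

namespace Literature.MathematicalPhysics.QuantumFieldTheory.Balaban1983to89.B16Ineq147Chain

open Real Finset
open Literature.MathematicalPhysics.QuantumFieldTheory.Balaban1983to89

noncomputable section

variable {α : Type*}

/-! ## §1. The first two lines of (1.47) typed (p. 368 [14]) -/

/-- **Line 1 of (1.47), the summand** (p. 368 [14], verbatim above): `B₃ exp(−δd(x, Ω″^{~2}_{h+1})) · O(1)L^{−N}B₃²B₅M⁶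
(α_{0,k} + α_{1,k}) · (1/g_k² + O(k − j)) ε_j` for a point `x ∈ Γ″_j` — over its letters: `dist x` =
`d(x, Ω″^{~2}_{h+1})`, `C` = the `O(1)`, `Linv` = `L⁻¹`, `alpha` = `α_{0,k} + α_{1,k}`, `C'` = the constant of `O(k − j)`,
`ε j` = `ε_j`. [cite: Balaban1989LargeFieldII, (1.47) p.368] -/
def term147a (B₃ δ C Linv B₅ M alpha gk C' : ℝ) (N k : ℕ) (ε : ℕ → ℝ) (dist : α → ℝ) (j : ℕ) (x : α) : ℝ :=
  B₃ * Real.exp (-(δ * dist x)) * (C * Linv ^ N * B₃ ^ 2 * B₅ * M ^ 6 * alpha) *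
    ((gk ^ 2)⁻¹ + C' * ((k : ℝ) - j)) * ε j

/-- **Line 1 of (1.47), the double sum** `Σ_{j=1}^{h} Σ_{x∈Γ″_j} (…)` of `term147a` over the sets `Γ j` = `Γ″_j` of the
generating set, `j = 1, …, h`. [cite: Balaban1989LargeFieldII, (1.47) p.368] -/
def rhs147a (B₃ δ C Linv B₅ M alpha gk C' : ℝ) (N k h : ℕ) (ε : ℕ → ℝ) (Γ : ℕ → Finset α)
    (dist : α → ℝ) : ℝ :=
  ∑ j ∈ Icc 1 h, ∑ x ∈ Γ j, term147a B₃ δ C Linv B₅ M alpha gk C' N k ε dist j x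

/-- **The first inequality of (1.47)** (p. 368 [14]): *"|⟨D𝐇″_{h+2}, (1/(g″_k(·))²)ζ₁η⁻²Im ∂U″_{h+2}⟩| < Σ_{j=1}^{h}
Σ_{x∈Γ″_j} B₃exp(−δd(x,Ω″^{~2}_{h+1}))O(1)L^{−N}B₃²B₅M⁶(α_{0,k} + α_{1,k})·(1/g_k² + O(k − j))ε_j"* — on the value `T` of
the term linear in `𝐇″_{h+2}`; the ANALYTIC input of the chain (exponential decay of `𝐇″_{h+2}`, Theorem 1 [15]), a
leaf. [cite: Balaban1989LargeFieldII, (1.47) p.368] -/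
def Ineq147First (T B₃ δ C Linv B₅ M alpha gk C' : ℝ) (N k h : ℕ) (ε : ℕ → ℝ) (Γ : ℕ → Finset α)
    (dist : α → ℝ) : Prop :=
  |T| < rhs147a B₃ δ C Linv B₅ M alpha gk C' N k h ε Γ dist

/-- **Line 2 of (1.47), the weight** `exp(−½δd(x, Ω″^{~2}_{h+1})) exp(−½δM(h − j)) (1 + h − j)^{1+β₀}` of a point
`x ∈ Γ″_j` (real power `1 + β₀`). [cite: Balaban1989LargeFieldII, (1.47) p.368] -/
def weight147 (δ M β₀ : ℝ) (h : ℕ) (dist : α → ℝ) (j : ℕ) (x : α) : ℝ :=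
  Real.exp (-(δ / 2 * dist x)) * Real.exp (-(δ / 2 * M * ((h : ℝ) - j))) * (1 + ((h : ℝ) - j)) ^ (1 + β₀)

/-- **Line 2 of (1.47), the double sum** `Σ_{j=1}^{h} Σ_{x∈Γ″_j} exp(−½δd(x,Ω″^{~2}_{h+1}))exp(−½δM(h − j))(1 + h −
j)^{1+β₀}`. [cite: Balaban1989LargeFieldII, (1.47) p.368] -/
def sum147b (δ M β₀ : ℝ) (h : ℕ) (Γ : ℕ → Finset α) (dist : α → ℝ) : ℝ :=
  ∑ j ∈ Icc 1 h, ∑ x ∈ Γ j, weight147 δ M β₀ h dist j x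

/-- **Line 2 of (1.47), the right side** `O(1)(1/g_k²)(α_{0,k} + α_{1,k})ε_kL^{−N}N^{1+β₀}·B₃³B₅M⁶·S` with `S` the
double sum `sum147b` (`C₂` = the `O(1)`). [cite: Balaban1989LargeFieldII, (1.47) p.368] -/
def rhs147b (C₂ gk alpha εk Linv : ℝ) (N : ℕ) (β₀ B₃ B₅ M S : ℝ) : ℝ :=
  C₂ * ((gk ^ 2)⁻¹ * alpha * εk) * Linv ^ N * (N : ℝ) ^ (1 + β₀) * (B₃ ^ 3 * B₅ * M ^ 6) * S

/-- **Line 3 of (1.47), the right side** `O(1)A₀C₁B₃³B₅M⁶p₀(g_k)q₁(g_k)R_k²L^{−N}|Γ″_h ∩ Ω″^{~2}_{h+1}|` (`cardΓ` =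
`|Γ″_h ∩ Ω″^{~2}_{h+1}|`) — letter for letter the left member of `B16Sect1Statements.ineq147_lastStep`. [cite: Balaban1989LargeFieldII, (1.47) p.368] -/
def rhs147c (C₃ A₀ C₁ B₃ B₅ M p₀g q₁g Rk Linv : ℝ) (N : ℕ) (cardΓ : ℝ) : ℝ :=
  C₃ * A₀ * C₁ * B₃ ^ 3 * B₅ * M ^ 6 * p₀g * q₁g * Rk ^ 2 * Linv ^ N * cardΓ

/-- The weight of line 2 is non-negative. [cite: Balaban1989LargeFieldII, (1.47) p.368] -/
theorem weight147_nonneg (δ M β₀ : ℝ) (h : ℕ) (dist : α → ℝ) {j : ℕ} (hj : j ≤ h) (x : α) :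
    0 ≤ weight147 δ M β₀ h dist j x := by
  unfold weight147
  have hm : (0 : ℝ) ≤ (h : ℝ) - j := by
    have : (j : ℝ) ≤ h := by exact_mod_cast hj
    linarith
  have : 0 ≤ (1 + ((h : ℝ) - j)) ^ (1 + β₀) := Real.rpow_nonneg (by linarith) _
  positivity

/-- The double sum of line 2 is non-negative. [cite: Balaban1989LargeFieldII, (1.47) p.368] -/
theorem sum147b_nonneg (δ M β₀ : ℝ) (h : ℕ) (Γ : ℕ → Finset α) (dist : α → ℝ) :
    0 ≤ sum147b δ M β₀ h Γ dist := by
  unfold sum147b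
  refine sum_nonneg fun j hj => sum_nonneg fun x _ => ?_
  exact weight147_nonneg δ M β₀ h dist (mem_Icc.mp hj).2 x

/-- The leading contribution of the printed count: at the top scale `j = h` a point with `d(x, Ω″^{~2}_{h+1}) = 0` (a point
of `Γ″_h ∩ Ω″^{~2}_{h+1}`) has weight exactly `1` — so `|Γ″_h ∩ Ω″^{~2}_{h+1}|` IS the sum of the weights of those points,
the term the third line of (1.47) keeps. [cite: Balaban1989LargeFieldII, (1.47) p.368] -/
theorem weight147_top_of_dist_zero (δ M β₀ : ℝ) (h : ℕ) {dist : α → ℝ} {x : α} (hx : dist x = 0) :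
    weight147 δ M β₀ h dist h x = 1 := by
  simp [weight147, hx]

/-! ## §2. Line 1 ⇒ line 2, term by term (p. 368 [14]) -/

/-- `exp(−δd) ≦ exp(−½δd)·exp(−½δM(h − j))` when `d ≧ M(h − j)` and `δ ≧ 0`: the splitting of the decay factor behind
the printed `exp(−½δd(x,Ω″^{~2}_{h+1}))exp(−½δM(h − j))`. [folklore] -/
private theorem exp_split_le {δ d M m : ℝ} (hδ : 0 ≤ δ) (hd : M * m ≤ d) :
    Real.exp (-(δ * d)) ≤ Real.exp (-(δ / 2 * d)) * Real.exp (-(δ / 2 * M * m)) := by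
  have e : Real.exp (-(δ * d)) = Real.exp (-(δ / 2 * d)) * Real.exp (-(δ / 2 * d)) := by
    rw [← Real.exp_add]; congr 1; ring
  rw [e]
  refine mul_le_mul_of_nonneg_left ?_ (Real.exp_pos _).le
  apply Real.exp_le_exp.mpr
  have : δ / 2 * (M * m) ≤ δ / 2 * d := mul_le_mul_of_nonneg_left hd (by positivity)
  linarith

/-- `x^{1+β₀} = x·x^{β₀}` for `x > 0` (real power). [folklore] -/
private theorem rpow_one_add {x β₀ : ℝ} (hx : 0 < x) : x ^ (1 + β₀) = x * x ^ β₀ := by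
  rw [Real.rpow_add hx, Real.rpow_one]

/-- **Line 1 ⇒ line 2 of (1.47), TERM BY TERM** (p. 368 [14]). For `x ∈ Γ″_j`, `1 ≦ j ≦ h`, `k = h + N`, `N ≧ 1`:
from `ε_j ≦ (1 + β₀)²(k − j)^{β₀}ε_k` (the third member of (2.8) [III], hypothesis `hε`), the separation `d(x,
Ω″^{~2}_{h+1}) ≧ M(h − j)` (hypothesis `hdist`, the content of the printed factor `exp(−½δM(h − j))`), `0 < g_k ≦ 1`
and non-negative constants: `B₃exp(−δd)·CL^{−N}B₃²B₅M⁶α·(g_k⁻² + C′(k − j))ε_j ≦ C(1 + C′)(1 + β₀)² ·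
g_k⁻²αε_k · L^{−N}N^{1+β₀} · B₃³B₅M⁶ · exp(−½δd)exp(−½δM(h − j))(1 + h − j)^{1+β₀}` — because `k − j = N + (h − j) ≦
N(1 + h − j)` and `g_k⁻² + C′(k − j) ≦ (1 + C′)g_k⁻²(k − j)`. PROVED. [cite: Balaban1989LargeFieldII, (1.47) p.368] -/
theorem term147a_le {B₃ δ C Linv B₅ M alpha gk C' εk β₀ : ℝ} {N k h : ℕ} {ε : ℕ → ℝ} {dist : α → ℝ}
    {j : ℕ} {x : α} (hB₃ : 0 ≤ B₃) (hC : 0 ≤ C) (hLinv : 0 ≤ Linv) (hB₅ : 0 ≤ B₅)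
    (hα : 0 ≤ alpha) (hgk : 0 < gk) (hgk1 : gk ≤ 1) (hC' : 0 ≤ C') (hεk : 0 ≤ εk) (hδ : 0 ≤ δ)
    (hβ₀ : 0 ≤ β₀) (hN : 1 ≤ N) (hk : k = h + N) (hj : j ∈ Icc 1 h)
    (hdist : M * ((h : ℝ) - j) ≤ dist x) (hε : ε j ≤ (1 + β₀) ^ 2 * ((k : ℝ) - j) ^ β₀ * εk) :
    term147a B₃ δ C Linv B₅ M alpha gk C' N k ε dist j x ≤
      (C * (1 + C') * (1 + β₀) ^ 2) * ((gk ^ 2)⁻¹ * alpha * εk) * Linv ^ N * (N : ℝ) ^ (1 + β₀) *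
        (B₃ ^ 3 * B₅ * M ^ 6) * weight147 δ M β₀ h dist j x := by
  have hjh : j ≤ h := (mem_Icc.mp hj).2
  set m : ℝ := (h : ℝ) - j with hm
  have hm0 : 0 ≤ m := by
    have : (j : ℝ) ≤ h := by exact_mod_cast hjh
    simp only [hm]; linarith
  have hN1 : (1 : ℝ) ≤ N := by exact_mod_cast hN
  have hkj : (k : ℝ) - j = N + m := by rw [hk]; push_cast; simp only [hm]; ring
  have hkj1 : 1 ≤ (k : ℝ) - j := by rw [hkj]; linarith
  have hkj0 : 0 < (k : ℝ) - j := by linarith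
  -- (s1) the decay factor
  have hE := exp_split_le (M := M) (m := m) hδ hdist
  -- (s3) 1/g_k² + C′(k−j) ≤ (1+C′) g_k⁻² (k−j)
  have hginv0 : 0 ≤ (gk ^ 2)⁻¹ := by positivity
  have hginv1 : 1 ≤ (gk ^ 2)⁻¹ := by
    rw [one_le_inv₀ (by positivity)]
    exact pow_le_one₀ hgk.le hgk1
  have h3 : (gk ^ 2)⁻¹ + C' * ((k : ℝ) - j) ≤ (1 + C') * (gk ^ 2)⁻¹ * ((k : ℝ) - j) := by
    have ha : (gk ^ 2)⁻¹ ≤ (gk ^ 2)⁻¹ * ((k : ℝ) - j) := le_mul_of_one_le_right hginv0 hkj1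
    have hb : C' * ((k : ℝ) - j) ≤ C' * ((gk ^ 2)⁻¹ * ((k : ℝ) - j)) :=
      mul_le_mul_of_nonneg_left (le_mul_of_one_le_left hkj0.le hginv1) hC'
    calc (gk ^ 2)⁻¹ + C' * ((k : ℝ) - j)
        ≤ (gk ^ 2)⁻¹ * ((k : ℝ) - j) + C' * ((gk ^ 2)⁻¹ * ((k : ℝ) - j)) := add_le_add ha hb
      _ = (1 + C') * (gk ^ 2)⁻¹ * ((k : ℝ) - j) := by ring
  -- (s2)+(s4) (k−j)·(k−j)^{β₀} = (k−j)^{1+β₀} ≤ N^{1+β₀}(1+m)^{1+β₀}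
  have h4 : ((k : ℝ) - j) * ((k : ℝ) - j) ^ β₀ ≤ (N : ℝ) ^ (1 + β₀) * (1 + m) ^ (1 + β₀) := by
    rw [← rpow_one_add hkj0, ← Real.mul_rpow (by positivity) (by positivity)]
    refine Real.rpow_le_rpow hkj0.le ?_ (by positivity)
    rw [hkj]
    nlinarith
  -- the bracket with ε_j
  have hG0 : 0 ≤ (gk ^ 2)⁻¹ + C' * ((k : ℝ) - j) := by positivity
  have hG : ((gk ^ 2)⁻¹ + C' * ((k : ℝ) - j)) * ε j ≤
      (1 + C') * (1 + β₀) ^ 2 * ((gk ^ 2)⁻¹ * εk) * ((N : ℝ) ^ (1 + β₀) * (1 + m) ^ (1 + β₀)) := by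
    have hd0 : 0 ≤ (1 + β₀) ^ 2 * ((k : ℝ) - j) ^ β₀ * εk := by positivity
    calc ((gk ^ 2)⁻¹ + C' * ((k : ℝ) - j)) * ε j
        ≤ ((gk ^ 2)⁻¹ + C' * ((k : ℝ) - j)) * ((1 + β₀) ^ 2 * ((k : ℝ) - j) ^ β₀ * εk) :=
          mul_le_mul_of_nonneg_left hε hG0
      _ ≤ ((1 + C') * (gk ^ 2)⁻¹ * ((k : ℝ) - j)) * ((1 + β₀) ^ 2 * ((k : ℝ) - j) ^ β₀ * εk) :=
          mul_le_mul_of_nonneg_right h3 hd0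
      _ = (1 + C') * (1 + β₀) ^ 2 * ((gk ^ 2)⁻¹ * εk) * (((k : ℝ) - j) * ((k : ℝ) - j) ^ β₀) := by ring
      _ ≤ (1 + C') * (1 + β₀) ^ 2 * ((gk ^ 2)⁻¹ * εk) * ((N : ℝ) ^ (1 + β₀) * (1 + m) ^ (1 + β₀)) :=
          mul_le_mul_of_nonneg_left h4 (by positivity)
  -- assemble
  have hK : 0 ≤ B₃ * (C * Linv ^ N * B₃ ^ 2 * B₅ * M ^ 6 * alpha) := by positivity
  have hG' : 0 ≤ (1 + C') * (1 + β₀) ^ 2 * ((gk ^ 2)⁻¹ * εk) * ((N : ℝ) ^ (1 + β₀) * (1 + m) ^ (1 + β₀)) := by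
    have : 0 ≤ (1 + m) ^ (1 + β₀) := Real.rpow_nonneg (by linarith) _
    positivity
  calc term147a B₃ δ C Linv B₅ M alpha gk C' N k ε dist j x
      = B₃ * (C * Linv ^ N * B₃ ^ 2 * B₅ * M ^ 6 * alpha) *
          ((((gk ^ 2)⁻¹ + C' * ((k : ℝ) - j)) * ε j) * Real.exp (-(δ * dist x))) := by
        unfold term147a; ring
    _ ≤ B₃ * (C * Linv ^ N * B₃ ^ 2 * B₅ * M ^ 6 * alpha) *
          (((1 + C') * (1 + β₀) ^ 2 * ((gk ^ 2)⁻¹ * εk) * ((N : ℝ) ^ (1 + β₀) * (1 + m) ^ (1 + β₀))) *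
            (Real.exp (-(δ / 2 * dist x)) * Real.exp (-(δ / 2 * M * m)))) :=
        mul_le_mul_of_nonneg_left (mul_le_mul hG hE (Real.exp_pos _).le hG') hK
    _ = (C * (1 + C') * (1 + β₀) ^ 2) * ((gk ^ 2)⁻¹ * alpha * εk) * Linv ^ N * (N : ℝ) ^ (1 + β₀) *
          (B₃ ^ 3 * B₅ * M ^ 6) * weight147 δ M β₀ h dist j x := by
        unfold weight147; simp only [hm]; ring

/-! ## §3. Line 1 ⇒ line 2, summed (p. 368 [14]) -/

/-- **Line 1 ⇒ line 2 of (1.47)** (p. 368 [14]): under the hypotheses of `term147a_le` for every `x ∈ Γ″_j`, `j = 1, …,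
h`, the double sum of line 1 is at most the right side of line 2 with `O(1) = C(1 + C′)(1 + β₀)²`:
*"Σ_{j=1}^{h}Σ_{x∈Γ″_j}B₃exp(−δd(x,Ω″^{~2}_{h+1}))O(1)L^{−N}B₃²B₅M⁶(α_{0,k}+α_{1,k})·(1/g_k²+O(k−j))ε_j ≦
O(1)(1/g_k²)(α_{0,k}+α_{1,k})ε_kL^{−N}N^{1+β₀}·B₃³B₅M⁶Σ_{j=1}^{h}Σ_{x∈Γ″_j}exp(−½δd(x,Ω″^{~2}_{h+1}))exp(−½δM(h−j))(1+h−j)^{1+β₀}"*.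
PROVED (term by term, `term147a_le`). [cite: Balaban1989LargeFieldII, (1.47) p.368] -/
theorem rhs147a_le_rhs147b {B₃ δ C Linv B₅ M alpha gk C' εk β₀ : ℝ} {N k h : ℕ} {ε : ℕ → ℝ}
    {Γ : ℕ → Finset α} {dist : α → ℝ} (hB₃ : 0 ≤ B₃) (hC : 0 ≤ C) (hLinv : 0 ≤ Linv) (hB₅ : 0 ≤ B₅)
    (hα : 0 ≤ alpha) (hgk : 0 < gk) (hgk1 : gk ≤ 1) (hC' : 0 ≤ C') (hεk : 0 ≤ εk)
    (hδ : 0 ≤ δ) (hβ₀ : 0 ≤ β₀) (hN : 1 ≤ N) (hk : k = h + N)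
    (hdist : ∀ j ∈ Icc 1 h, ∀ x ∈ Γ j, M * ((h : ℝ) - j) ≤ dist x)
    (hε : ∀ j ∈ Icc 1 h, ε j ≤ (1 + β₀) ^ 2 * ((k : ℝ) - j) ^ β₀ * εk) :
    rhs147a B₃ δ C Linv B₅ M alpha gk C' N k h ε Γ dist ≤
      rhs147b (C * (1 + C') * (1 + β₀) ^ 2) gk alpha εk Linv N β₀ B₃ B₅ M (sum147b δ M β₀ h Γ dist) := by
  unfold rhs147a rhs147b sum147b
  rw [mul_sum]
  refine sum_le_sum fun j hj => ?_
  rw [mul_sum]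
  refine sum_le_sum fun x hx => ?_
  exact term147a_le hB₃ hC hLinv hB₅ hα hgk hgk1 hC' hεk hδ hβ₀ hN hk hj (hdist j hj x hx) (hε j hj)

/-- The printed input `ε_j ≦ (1 + β₀)²(k − j)^{β₀}ε_k` of the step, OBTAINED from the [III] (2.8) record `B14.FlowIneq28`
(second member `ε_m ≦ (1 + β₀)(1 + g_n²β′(n − m))^{β₀}ε_n`) and the printed comparison `(1 + β₀)(1 + g_k²β′(k − j))^{β₀}
≦ (1 + β₀)²(k − j)^{β₀}` of its third member (`B14FlowStep.third_members`, second conjunct — taken as the hypothesis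
`hthird`), for `j < k ≦ K` and `ε_k ≧ 0`. PROVED (bookkeeping). [cite: Balaban1988Convergent, (2.8) p.256] -/
theorem eps_third_member_of_flowIneq28 {ε g : ℕ → ℝ} {β' β₀ : ℝ} {K k j : ℕ}
    (h28 : B14.FlowIneq28 ε g β' β₀ K) (hjk : j < k) (hkK : k ≤ K) (hεk : 0 ≤ ε k)
    (hthird : (1 + β₀) * (1 + (g k) ^ 2 * β' * ((k : ℝ) - j)) ^ β₀ ≤ (1 + β₀) ^ 2 * ((k : ℝ) - j) ^ β₀) :
    ε j ≤ (1 + β₀) ^ 2 * ((k : ℝ) - j) ^ β₀ * ε k :=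
  ((h28 j k hjk hkK).2).trans (mul_le_mul_of_nonneg_right hthird hεk)

/-! ## §4. Line 2 ⇒ line 3 (p. 368 [14]) -/

/-- `N^{1+β₀} ≦ R_k²` from *"N ≦ R_k"* (p. 361, `B16Sect1Kernels.NWindowUpper`), `N ≧ 1` and `β₀ ≦ 1`: the passage from
the factor `N^{1+β₀}` of line 2 to the factor `R_k²` of line 3. PROVED. [cite: Balaban1989LargeFieldII, (1.47) p.368] -/
theorem N_rpow_le_Rk_sq {N : ℕ} {Rk β₀ : ℝ} (hN1 : 1 ≤ N) (hβ₁ : β₀ ≤ 1)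
    (hN : B16Sect1Kernels.NWindowUpper N Rk) : (N : ℝ) ^ (1 + β₀) ≤ Rk ^ 2 := by
  have hN' : (N : ℝ) ≤ Rk := hN
  have hN1' : (1 : ℝ) ≤ N := by exact_mod_cast hN1
  calc (N : ℝ) ^ (1 + β₀) ≤ (N : ℝ) ^ (2 : ℝ) := Real.rpow_le_rpow_of_exponent_le hN1' (by linarith)
    _ = (N : ℝ) ^ 2 := Real.rpow_two _
    _ ≤ Rk ^ 2 := pow_le_pow_left₀ (by linarith) hN' 2

/-- **Line 2 ⇒ line 3 of (1.47)** (p. 368 [14]): with the dictionary `α_{0,k} + α_{1,k} = C₁g_kq₁(g_k)`, `ε_k =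
g_kA₀p₀(g_k)` ([III] (2.2)–(2.5); `B16Sect1Statements.alphaEps_div_gsq` BY NAME: `g_k⁻²(α_{0,k}+α_{1,k})ε_k =
A₀C₁p₀(g_k)q₁(g_k)`), *"N ≦ R_k"* (`B16Sect1Kernels.NWindowUpper`, whence `N^{1+β₀} ≦ R_k²` for `β₀ ≦ 1`), and the
printed step's implicit count of the double sum of line 2 by `O(1)|Γ″_h ∩ Ω″^{~2}_{h+1}|` (hypothesis `hS`, constant `CΓ`;
not derived here — §5 reduces it to a per-scale count): *"≦ O(1)A₀C₁B₃³B₅M⁶p₀(g_k)q₁(g_k)R_k²L^{−N}|Γ″_h ∩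
Ω″^{~2}_{h+1}|"* with `O(1) = C₂·CΓ`. PROVED. [cite: Balaban1989LargeFieldII, (1.47) p.368] -/
theorem rhs147b_le_rhs147c {C₂ gk alpha εk Linv β₀ B₃ B₅ M C₁ q₁g A₀ p₀g Rk CΓ cardΓ S : ℝ} {N : ℕ}
    (hC₂ : 0 ≤ C₂) (hgk : gk ≠ 0) (hα : 0 ≤ alpha) (hεk : 0 ≤ εk) (hLinv : 0 ≤ Linv) (hB₃ : 0 ≤ B₃)
    (hB₅ : 0 ≤ B₅) (hαeq : alpha = C₁ * gk * q₁g) (hεeq : εk = gk * A₀ * p₀g) (hN1 : 1 ≤ N)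
    (hβ₁ : β₀ ≤ 1) (hN : B16Sect1Kernels.NWindowUpper N Rk) (hS0 : 0 ≤ S) (hS : S ≤ CΓ * cardΓ) :
    rhs147b C₂ gk alpha εk Linv N β₀ B₃ B₅ M S ≤ rhs147c (C₂ * CΓ) A₀ C₁ B₃ B₅ M p₀g q₁g Rk Linv N cardΓ := by
  have hdict := B16Sect1Statements.alphaEps_div_gsq hgk hαeq hεeq
  have hP0 : 0 ≤ (gk ^ 2)⁻¹ * alpha * εk := by positivity
  have hNR := N_rpow_le_Rk_sq (β₀ := β₀) hN1 hβ₁ hN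
  have hRk0 : 0 ≤ Rk ^ 2 := by positivity
  unfold rhs147b rhs147c
  calc C₂ * ((gk ^ 2)⁻¹ * alpha * εk) * Linv ^ N * (N : ℝ) ^ (1 + β₀) * (B₃ ^ 3 * B₅ * M ^ 6) * S
      = (C₂ * ((gk ^ 2)⁻¹ * alpha * εk) * Linv ^ N * (B₃ ^ 3 * B₅ * M ^ 6) * S) * (N : ℝ) ^ (1 + β₀) := by
        ring
    _ ≤ (C₂ * ((gk ^ 2)⁻¹ * alpha * εk) * Linv ^ N * (B₃ ^ 3 * B₅ * M ^ 6) * S) * Rk ^ 2 :=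
        mul_le_mul_of_nonneg_left hNR (by positivity)
    _ = (C₂ * ((gk ^ 2)⁻¹ * alpha * εk) * Linv ^ N * (B₃ ^ 3 * B₅ * M ^ 6) * Rk ^ 2) * S := by ring
    _ ≤ (C₂ * ((gk ^ 2)⁻¹ * alpha * εk) * Linv ^ N * (B₃ ^ 3 * B₅ * M ^ 6) * Rk ^ 2) * (CΓ * cardΓ) :=
        mul_le_mul_of_nonneg_left hS (by positivity)
    _ = C₂ * CΓ * A₀ * C₁ * B₃ ^ 3 * B₅ * M ^ 6 * p₀g * q₁g * Rk ^ 2 * Linv ^ N * cardΓ := by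
        rw [hdict]; ring

/-! ## §5. The scale sum of line 2 (p. 368 [14]): `Σ_{j=1}^{h} exp(−½δM(h − j))(1 + h − j)^{1+β₀} ≦ 2` -/

/-- `exp(−1) ≦ ½`. [folklore] -/
private theorem exp_neg_one_le_half : Real.exp (-1) ≤ 1 / 2 := by
  have h2 : (2 : ℝ) ≤ Real.exp 1 := by
    have := Real.add_one_le_exp (1 : ℝ)
    norm_num at this ⊢
    exact this
  rw [Real.exp_neg, one_div]
  exact inv_anti₀ (by norm_num) h2

/-- One term of the scale sum: `exp(−am)(1 + m)^{1+β₀} ≦ (½)^m` for a natural number `m`, `a ≧ 3`, `0 ≦ β₀ ≦ 1`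
(`(1 + m)^{1+β₀} ≦ (1 + m)² ≦ e^{2m}`, `e^{(2−a)m} ≦ e^{−m} ≦ 2^{−m}`). [folklore] -/
private theorem scale_term_le {a β₀ : ℝ} (ha : 3 ≤ a) (hβ₁ : β₀ ≤ 1) (m : ℕ) :
    Real.exp (-(a * m)) * (1 + (m : ℝ)) ^ (1 + β₀) ≤ (1 / 2 : ℝ) ^ m := by
  have hm0 : (0 : ℝ) ≤ m := Nat.cast_nonneg m
  -- (1+m)^{1+β₀} ≤ (1+m)^2 ≤ exp(m)^2
  have h1 : (1 + (m : ℝ)) ^ (1 + β₀) ≤ (1 + (m : ℝ)) ^ 2 := by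
    calc (1 + (m : ℝ)) ^ (1 + β₀) ≤ (1 + (m : ℝ)) ^ (2 : ℝ) :=
          Real.rpow_le_rpow_of_exponent_le (by linarith) (by linarith)
      _ = (1 + (m : ℝ)) ^ 2 := Real.rpow_two _
  have h2 : (1 + (m : ℝ)) ^ 2 ≤ Real.exp m ^ 2 := by
    have := Real.add_one_le_exp (m : ℝ)
    exact pow_le_pow_left₀ (by linarith) (by linarith) 2
  have h12 : (1 + (m : ℝ)) ^ (1 + β₀) ≤ Real.exp (2 * m) := by
    calc (1 + (m : ℝ)) ^ (1 + β₀) ≤ Real.exp m ^ 2 := h1.trans h2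
      _ = Real.exp (2 * m) := by rw [sq, ← Real.exp_add]; ring_nf
  -- exp(-a m) exp(2 m) ≤ exp(-m) ≤ (1/2)^m
  have h3 : Real.exp (-(a * m)) * Real.exp (2 * m) ≤ Real.exp (-(m : ℝ)) := by
    rw [← Real.exp_add, Real.exp_le_exp]
    nlinarith
  have h4 : Real.exp (-(m : ℝ)) ≤ (1 / 2 : ℝ) ^ m := by
    have e : Real.exp (-(m : ℝ)) = Real.exp (-1) ^ m := by
      rw [← Real.exp_nat_mul]; ring_nf
    rw [e]
    exact pow_le_pow_left₀ (Real.exp_pos _).le exp_neg_one_le_half m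
  calc Real.exp (-(a * m)) * (1 + (m : ℝ)) ^ (1 + β₀)
      ≤ Real.exp (-(a * m)) * Real.exp (2 * m) := mul_le_mul_of_nonneg_left h12 (Real.exp_pos _).le
    _ ≤ (1 / 2 : ℝ) ^ m := h3.trans h4

/-- **The scale sum of line 2 of (1.47) is `O(1)`** (p. 368 [14]; the located largeness of `δM` as in the p. 362
absorption, here `δM ≧ 6`): for `0 ≦ β₀ ≦ 1`, `Σ_{j=1}^{h} exp(−½δM(h − j))(1 + h − j)^{1+β₀} ≦ Σ_{m=0}^{h−1} 2^{−m} ≦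
2`. PROVED. [cite: Balaban1989LargeFieldII, (1.47) p.368] -/
theorem scaleSum_le_two {δ M β₀ : ℝ} (hδM : 6 ≤ δ * M) (hβ₁ : β₀ ≤ 1) (h : ℕ) :
    ∑ j ∈ Icc 1 h, Real.exp (-(δ / 2 * M * ((h : ℝ) - j))) * (1 + ((h : ℝ) - j)) ^ (1 + β₀) ≤ 2 := by
  have ha : 3 ≤ δ / 2 * M := by linarith
  have hterm : ∀ j ∈ Icc 1 h,
      Real.exp (-(δ / 2 * M * ((h : ℝ) - j))) * (1 + ((h : ℝ) - j)) ^ (1 + β₀) ≤ (1 / 2 : ℝ) ^ (h - j) := by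
    intro j hj
    have hjh : j ≤ h := (mem_Icc.mp hj).2
    have e : (h : ℝ) - j = ((h - j : ℕ) : ℝ) := by rw [Nat.cast_sub hjh]
    rw [e]
    exact scale_term_le ha hβ₁ (h - j)
  have hreindex : ∑ j ∈ Icc 1 h, (1 / 2 : ℝ) ^ (h - j) = ∑ m ∈ range h, (1 / 2 : ℝ) ^ m := by
    refine sum_nbij' (fun j => h - j) (fun m => h - m) ?_ ?_ ?_ ?_ ?_
    · intro j hj; have := mem_Icc.mp hj; simp only [mem_range]; omega
    · intro m hm; have := mem_range.mp hm; simp only [mem_Icc]; omega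
    · intro j hj; have := mem_Icc.mp hj; omega
    · intro m hm; have := mem_range.mp hm; omega
    · intro j _; rfl
  calc ∑ j ∈ Icc 1 h, Real.exp (-(δ / 2 * M * ((h : ℝ) - j))) * (1 + ((h : ℝ) - j)) ^ (1 + β₀)
      ≤ ∑ j ∈ Icc 1 h, (1 / 2 : ℝ) ^ (h - j) := sum_le_sum hterm
    _ = ∑ m ∈ range h, (1 / 2 : ℝ) ^ m := hreindex
    _ ≤ 2 := sum_geometric_two_le h

/-- **The double sum of line 2 from a per-scale count** (p. 368 [14]): if for every scale `j = 1, …, h` the lattice sum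
`Σ_{x∈Γ″_j} exp(−½δd(x, Ω″^{~2}_{h+1}))` is at most `CΓ·|Γ″_h ∩ Ω″^{~2}_{h+1}|` (hypothesis `hcount` — the geometric count
of the points of `Γ″_j` near `Ω″^{~2}_{h+1}`, not derived here), then with `δM ≧ 6`, `0 ≦ β₀ ≦ 1` the double sum of
line 2 is at most `2CΓ·|Γ″_h ∩ Ω″^{~2}_{h+1}|` (`scaleSum_le_two`). PROVED. [cite: Balaban1989LargeFieldII, (1.47) p.368] -/
theorem sum147b_le_of_count {δ M β₀ CΓ cardΓ : ℝ} {h : ℕ} {Γ : ℕ → Finset α} {dist : α → ℝ}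
    (hδM : 6 ≤ δ * M) (hβ₁ : β₀ ≤ 1) (hCΓ : 0 ≤ CΓ) (hcard : 0 ≤ cardΓ)
    (hcount : ∀ j ∈ Icc 1 h, ∑ x ∈ Γ j, Real.exp (-(δ / 2 * dist x)) ≤ CΓ * cardΓ) :
    sum147b δ M β₀ h Γ dist ≤ 2 * CΓ * cardΓ := by
  unfold sum147b weight147
  have hstep : ∀ j ∈ Icc 1 h,
      ∑ x ∈ Γ j, Real.exp (-(δ / 2 * dist x)) * Real.exp (-(δ / 2 * M * ((h : ℝ) - j))) *
          (1 + ((h : ℝ) - j)) ^ (1 + β₀) ≤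
        (CΓ * cardΓ) * (Real.exp (-(δ / 2 * M * ((h : ℝ) - j))) * (1 + ((h : ℝ) - j)) ^ (1 + β₀)) := by
    intro j hj
    have hjh : j ≤ h := (mem_Icc.mp hj).2
    have hw : 0 ≤ Real.exp (-(δ / 2 * M * ((h : ℝ) - j))) * (1 + ((h : ℝ) - j)) ^ (1 + β₀) := by
      have : (j : ℝ) ≤ h := by exact_mod_cast hjh
      have : 0 ≤ (1 + ((h : ℝ) - j)) ^ (1 + β₀) := Real.rpow_nonneg (by linarith) _
      positivity
    have e : ∑ x ∈ Γ j, Real.exp (-(δ / 2 * dist x)) * Real.exp (-(δ / 2 * M * ((h : ℝ) - j))) *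
          (1 + ((h : ℝ) - j)) ^ (1 + β₀) =
        (∑ x ∈ Γ j, Real.exp (-(δ / 2 * dist x))) *
          (Real.exp (-(δ / 2 * M * ((h : ℝ) - j))) * (1 + ((h : ℝ) - j)) ^ (1 + β₀)) := by
      rw [sum_mul]
      exact sum_congr rfl fun x _ => by ring
    rw [e]
    exact mul_le_mul_of_nonneg_right (hcount j hj) hw
  calc ∑ j ∈ Icc 1 h, ∑ x ∈ Γ j, Real.exp (-(δ / 2 * dist x)) * Real.exp (-(δ / 2 * M * ((h : ℝ) - j))) *
          (1 + ((h : ℝ) - j)) ^ (1 + β₀)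
      ≤ ∑ j ∈ Icc 1 h, (CΓ * cardΓ) *
          (Real.exp (-(δ / 2 * M * ((h : ℝ) - j))) * (1 + ((h : ℝ) - j)) ^ (1 + β₀)) := sum_le_sum hstep
    _ = (CΓ * cardΓ) * ∑ j ∈ Icc 1 h,
          Real.exp (-(δ / 2 * M * ((h : ℝ) - j))) * (1 + ((h : ℝ) - j)) ^ (1 + β₀) := by rw [mul_sum]
    _ ≤ (CΓ * cardΓ) * 2 := mul_le_mul_of_nonneg_left (scaleSum_le_two hδM hβ₁ h) (by positivity)
    _ = 2 * CΓ * cardΓ := by ring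

/-! ## §6. (1.47) assembled from its first line (p. 368 [14]) -/

/-- **(1.47) from its first line** (p. 368 [14]): the analytic first inequality `Ineq147First` (leaf), the inputs of the
two middle steps (`rhs147a_le_rhs147b`, `rhs147b_le_rhs147c`: (2.8) [III] third member `hε`, separation `hdist`, `k = h
+ N`, `0 < g_k ≦ 1`, dictionary `hαeq`/`hεeq`, *"N ≦ R_k"*, `β₀ ≦ 1`, the double-sum count `hS`) and the count
`|Γ″_h ∩ Ω″^{~2}_{h+1}| ≦ O(1)M⁴R_k⁵` of the last step (`hΓ`, as in `B16Sect1Statements.ineq147_lastStep`) give the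
sibling's typed final form `B16Sect1Statements.Ineq147` BY NAME, with the explicit `O(1) = C(1 + C′)(1 + β₀)²·CΓ·Cγ`:
*"|⟨D𝐇″_{h+2}, …⟩| < … ≦ O(1)A₀C₁B₃³B₅M^{10}p₀(g_k)q₁(g_k)R_k⁷L^{−N}"*. PROVED. [cite: Balaban1989LargeFieldII, (1.47) p.368] -/
theorem ineq147_of_first {T B₃ δ C Linv B₅ M alpha gk C' εk β₀ C₁ q₁g A₀ p₀g Rk CΓ cardΓ Cγ : ℝ}
    {N k h : ℕ} {ε : ℕ → ℝ} {Γ : ℕ → Finset α} {dist : α → ℝ}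
    (hfirst : Ineq147First T B₃ δ C Linv B₅ M alpha gk C' N k h ε Γ dist)
    (hB₃ : 0 ≤ B₃) (hC : 0 ≤ C) (hLinv : 0 ≤ Linv) (hB₅ : 0 ≤ B₅) (hα : 0 ≤ alpha)
    (hgk : 0 < gk) (hgk1 : gk ≤ 1) (hC' : 0 ≤ C') (hεk : 0 ≤ εk) (hδ : 0 ≤ δ) (hβ₀ : 0 ≤ β₀)
    (hβ₁ : β₀ ≤ 1) (hN : 1 ≤ N) (hk : k = h + N)
    (hdist : ∀ j ∈ Icc 1 h, ∀ x ∈ Γ j, M * ((h : ℝ) - j) ≤ dist x)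
    (hε : ∀ j ∈ Icc 1 h, ε j ≤ (1 + β₀) ^ 2 * ((k : ℝ) - j) ^ β₀ * εk)
    (hαeq : alpha = C₁ * gk * q₁g) (hεeq : εk = gk * A₀ * p₀g) (hNW : B16Sect1Kernels.NWindowUpper N Rk)
    (hCΓ : 0 ≤ CΓ) (hS : sum147b δ M β₀ h Γ dist ≤ CΓ * cardΓ) (hΓ : cardΓ ≤ Cγ * M ^ 4 * Rk ^ 5) :
    B16Sect1Statements.Ineq147 T ((C * (1 + C') * (1 + β₀) ^ 2 * CΓ) * Cγ) A₀ C₁ B₃ B₅ M p₀g q₁g Rk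
      Linv N := by
  unfold B16Sect1Statements.Ineq147
  have h12 := rhs147a_le_rhs147b (Γ := Γ) hB₃ hC hLinv hB₅ hα hgk hgk1 hC' hεk hδ hβ₀ hN hk hdist hε
  have h23 := rhs147b_le_rhs147c (β₀ := β₀) (B₃ := B₃) (B₅ := B₅) (M := M) (Linv := Linv) (N := N)
    (by positivity : 0 ≤ C * (1 + C') * (1 + β₀) ^ 2) hgk.ne' hα hεk hLinv hB₃ hB₅ hαeq hεeq hN hβ₁
    hNW (sum147b_nonneg δ M β₀ h Γ dist) hS
  -- prefactor of the last step is non-negative (A₀C₁p₀q₁ = g_k⁻²αε_k ≥ 0)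
  have hdict := B16Sect1Statements.alphaEps_div_gsq hgk.ne' hαeq hεeq
  have hP0 : 0 ≤ A₀ * C₁ * p₀g * q₁g := by rw [← hdict]; positivity
  have hpre : 0 ≤ C * (1 + C') * (1 + β₀) ^ 2 * CΓ * A₀ * C₁ * B₃ ^ 3 * B₅ * M ^ 6 * p₀g * q₁g *
      Rk ^ 2 * Linv ^ N := by
    have hNR := N_rpow_le_Rk_sq (β₀ := β₀) hN hβ₁ hNW
    have hRk0 : 0 ≤ Rk ^ 2 := (Real.rpow_nonneg (Nat.cast_nonneg N) _).trans hNR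
    have e : C * (1 + C') * (1 + β₀) ^ 2 * CΓ * A₀ * C₁ * B₃ ^ 3 * B₅ * M ^ 6 * p₀g * q₁g * Rk ^ 2 *
        Linv ^ N = (C * (1 + C') * (1 + β₀) ^ 2 * CΓ * B₃ ^ 3 * B₅ * M ^ 6 * Linv ^ N) *
          (A₀ * C₁ * p₀g * q₁g) * Rk ^ 2 := by ring
    rw [e]; positivity
  have h34 := B16Sect1Statements.ineq147_lastStep hpre hΓ
  unfold Ineq147First at hfirst
  unfold rhs147c at h23
  exact lt_of_lt_of_le hfirst ((h12.trans h23).trans h34)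

/-- **(1.47) from its first line, the double-sum count reduced to a per-scale count** (p. 368 [14]): as
`ineq147_of_first`, with `hS` discharged by `sum147b_le_of_count` from the per-scale count `hcount` and `δM ≧ 6`
(the located largeness of `δM`); `O(1) = C(1 + C′)(1 + β₀)²·2CΓ·Cγ`. PROVED. [cite: Balaban1989LargeFieldII, (1.47) p.368] -/
theorem ineq147_of_first_count {T B₃ δ C Linv B₅ M alpha gk C' εk β₀ C₁ q₁g A₀ p₀g Rk CΓ cardΓ Cγ : ℝ}
    {N k h : ℕ} {ε : ℕ → ℝ} {Γ : ℕ → Finset α} {dist : α → ℝ}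
    (hfirst : Ineq147First T B₃ δ C Linv B₅ M alpha gk C' N k h ε Γ dist)
    (hB₃ : 0 ≤ B₃) (hC : 0 ≤ C) (hLinv : 0 ≤ Linv) (hB₅ : 0 ≤ B₅) (hα : 0 ≤ alpha)
    (hgk : 0 < gk) (hgk1 : gk ≤ 1) (hC' : 0 ≤ C') (hεk : 0 ≤ εk) (hδ : 0 ≤ δ) (hβ₀ : 0 ≤ β₀)
    (hβ₁ : β₀ ≤ 1) (hN : 1 ≤ N) (hk : k = h + N) (hδM : 6 ≤ δ * M)
    (hdist : ∀ j ∈ Icc 1 h, ∀ x ∈ Γ j, M * ((h : ℝ) - j) ≤ dist x)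
    (hε : ∀ j ∈ Icc 1 h, ε j ≤ (1 + β₀) ^ 2 * ((k : ℝ) - j) ^ β₀ * εk)
    (hαeq : alpha = C₁ * gk * q₁g) (hεeq : εk = gk * A₀ * p₀g) (hNW : B16Sect1Kernels.NWindowUpper N Rk)
    (hCΓ : 0 ≤ CΓ) (hcard : 0 ≤ cardΓ)
    (hcount : ∀ j ∈ Icc 1 h, ∑ x ∈ Γ j, Real.exp (-(δ / 2 * dist x)) ≤ CΓ * cardΓ)
    (hΓ : cardΓ ≤ Cγ * M ^ 4 * Rk ^ 5) :
    B16Sect1Statements.Ineq147 T ((C * (1 + C') * (1 + β₀) ^ 2 * (2 * CΓ)) * Cγ) A₀ C₁ B₃ B₅ M p₀g q₁g Rk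
      Linv N := by
  have hS : sum147b δ M β₀ h Γ dist ≤ (2 * CΓ) * cardΓ := by
    have := sum147b_le_of_count (Γ := Γ) (dist := dist) hδM hβ₁ hCΓ hcard hcount
    linarith
  exact ineq147_of_first hfirst hB₃ hC hLinv hB₅ hα hgk hgk1 hC' hεk hδ hβ₀ hβ₁ hN hk hdist hε hαeq hεeq
    hNW (by positivity) hS hΓ

/-! ## §7 (v1.1, append-only). The double-sum count on the MULTI-SCALE generating set (p. 368 [14]; (1.13) [IV])

Scope note on §5.  Print's implicit step is the bound of the WHOLE double sum of line 2 by `O(1)|Γ″_h ∩ Ω″^{~2}_{h+1}|`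
(hypothesis `hS` of `rhs147b_le_rhs147c` / `ineq147_of_first`).  The per-scale count `hcount` of `sum147b_le_of_count`,
uniform in `j`, is a SUFFICIENT condition of ours, and a stronger one than print needs: for `j < h` the sets `Γ″_j` lie
on the finer lattices `L^jη` ((1.13) [IV]: `Γ″_j = (Ω″_j∖Ω″_{j+1})^{(j)}`, the superscript `(j)` selecting the
points of the `j`-th lattice `L^jη·ℤ^d` — the convention of Sect. 0 [I] used in (2.2) [III]), so their point counts
carry a density factor growing in `h − j`, which print's `O(1)` balances against the factor `exp(−½δM(h − j))` INSIDE
the double sum.  This section records that balance: a per-scale count allowed to GROW geometrically, `Σ_{x∈Γ″_j}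
exp(−½δd(x,Ω″^{~2}_{h+1})) ≦ CΓ·|Γ″_h ∩ Ω″^{~2}_{h+1}|·G^{h−j}` (any growth factor `G ≧ 1`, e.g. `G = L^d`), still gives
the double-sum count `hS` with `O(1) = 2CΓ`, provided the located largeness of `δM` is strengthened to `δM ≧ 6 + 2log G`
(`scaleSum_le_two_of_growth`, `sum147b_le_of_growing_count`, `ineq147_of_first_growing_count`).  Nothing else changes. -/

/-- One term of the scale sum with a growth factor: `G^m·exp(−am)(1 + m)^{1+β₀} ≦ (½)^m` for `G ≧ 1`, `a ≧ 3 + log G`,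
`β₀ ≦ 1` (`G^m e^{−am} = e^{−(a − log G)m}` and the growth-free term bound). [folklore] -/
private theorem scale_term_growth_le {a β₀ G : ℝ} (hG : 1 ≤ G) (ha : 3 + Real.log G ≤ a) (hβ₁ : β₀ ≤ 1)
    (m : ℕ) : G ^ m * (Real.exp (-(a * m)) * (1 + (m : ℝ)) ^ (1 + β₀)) ≤ (1 / 2 : ℝ) ^ m := by
  have hG0 : 0 < G := by linarith
  have e : G ^ m * Real.exp (-(a * m)) = Real.exp (-((a - Real.log G) * m)) := by
    rw [← Real.rpow_natCast G m, Real.rpow_def_of_pos hG0, ← Real.exp_add]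
    congr 1; ring
  calc G ^ m * (Real.exp (-(a * m)) * (1 + (m : ℝ)) ^ (1 + β₀))
      = Real.exp (-((a - Real.log G) * m)) * (1 + (m : ℝ)) ^ (1 + β₀) := by rw [← mul_assoc, e]
    _ ≤ (1 / 2 : ℝ) ^ m := scale_term_le (by linarith) hβ₁ m

/-- **The scale sum with a geometric density factor is still `O(1)`** (p. 368 [14]; the multi-scale lattices of (1.13) [IV]):
for `G ≧ 1`, `δM ≧ 6 + 2log G`, `β₀ ≦ 1`: `Σ_{j=1}^{h} G^{h−j}·exp(−½δM(h − j))(1 + h − j)^{1+β₀} ≦ 2`. PROVED. [cite: Balaban1989LargeFieldII, (1.47) p.368] -/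
theorem scaleSum_le_two_of_growth {δ M β₀ G : ℝ} (hG : 1 ≤ G) (hδM : 6 + 2 * Real.log G ≤ δ * M)
    (hβ₁ : β₀ ≤ 1) (h : ℕ) :
    ∑ j ∈ Icc 1 h, G ^ (h - j) *
        (Real.exp (-(δ / 2 * M * ((h : ℝ) - j))) * (1 + ((h : ℝ) - j)) ^ (1 + β₀)) ≤ 2 := by
  have ha : 3 + Real.log G ≤ δ / 2 * M := by linarith
  have hterm : ∀ j ∈ Icc 1 h, G ^ (h - j) *
      (Real.exp (-(δ / 2 * M * ((h : ℝ) - j))) * (1 + ((h : ℝ) - j)) ^ (1 + β₀)) ≤ (1 / 2 : ℝ) ^ (h - j) := by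
    intro j hj
    have hjh : j ≤ h := (mem_Icc.mp hj).2
    have e : (h : ℝ) - j = ((h - j : ℕ) : ℝ) := by rw [Nat.cast_sub hjh]
    rw [e]
    exact scale_term_growth_le hG ha hβ₁ (h - j)
  have hreindex : ∑ j ∈ Icc 1 h, (1 / 2 : ℝ) ^ (h - j) = ∑ m ∈ range h, (1 / 2 : ℝ) ^ m := by
    refine sum_nbij' (fun j => h - j) (fun m => h - m) ?_ ?_ ?_ ?_ ?_
    · intro j hj; have := mem_Icc.mp hj; simp only [mem_range]; omega
    · intro m hm; have := mem_range.mp hm; simp only [mem_Icc]; omega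
    · intro j hj; have := mem_Icc.mp hj; omega
    · intro m hm; have := mem_range.mp hm; omega
    · intro j _; rfl
  calc ∑ j ∈ Icc 1 h, G ^ (h - j) *
        (Real.exp (-(δ / 2 * M * ((h : ℝ) - j))) * (1 + ((h : ℝ) - j)) ^ (1 + β₀))
      ≤ ∑ j ∈ Icc 1 h, (1 / 2 : ℝ) ^ (h - j) := sum_le_sum hterm
    _ = ∑ m ∈ range h, (1 / 2 : ℝ) ^ m := hreindex
    _ ≤ 2 := sum_geometric_two_le h

/-- **The double sum of line 2 from a per-scale count WITH multi-scale density growth** (p. 368 [14]; (1.13) [IV]):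
if for every `j = 1, …, h` the lattice sum `Σ_{x∈Γ″_j} exp(−½δd(x,Ω″^{~2}_{h+1}))` is at most `CΓ·|Γ″_h ∩
Ω″^{~2}_{h+1}|·G^{h−j}` (hypothesis `hcount`; `G ≧ 1` the per-scale density growth, e.g. `L^d` per scale for the finer
lattices `L^jη` of (1.13) [IV]; geometric, not derived here), then with `δM ≧ 6 + 2log G`, `β₀ ≦ 1` the double sum of line 2 is at most
`2CΓ·|Γ″_h ∩ Ω″^{~2}_{h+1}|` — print's implicit count `hS` with `O(1) = 2CΓ`. PROVED. [cite: Balaban1989LargeFieldII, (1.47) p.368] -/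
theorem sum147b_le_of_growing_count {δ M β₀ CΓ cardΓ G : ℝ} {h : ℕ} {Γ : ℕ → Finset α} {dist : α → ℝ}
    (hG : 1 ≤ G) (hδM : 6 + 2 * Real.log G ≤ δ * M) (hβ₁ : β₀ ≤ 1) (hCΓ : 0 ≤ CΓ) (hcard : 0 ≤ cardΓ)
    (hcount : ∀ j ∈ Icc 1 h, ∑ x ∈ Γ j, Real.exp (-(δ / 2 * dist x)) ≤ CΓ * cardΓ * G ^ (h - j)) :
    sum147b δ M β₀ h Γ dist ≤ 2 * CΓ * cardΓ := by
  unfold sum147b weight147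
  have hstep : ∀ j ∈ Icc 1 h,
      ∑ x ∈ Γ j, Real.exp (-(δ / 2 * dist x)) * Real.exp (-(δ / 2 * M * ((h : ℝ) - j))) *
          (1 + ((h : ℝ) - j)) ^ (1 + β₀) ≤
        (CΓ * cardΓ) * (G ^ (h - j) *
          (Real.exp (-(δ / 2 * M * ((h : ℝ) - j))) * (1 + ((h : ℝ) - j)) ^ (1 + β₀))) := by
    intro j hj
    have hjh : j ≤ h := (mem_Icc.mp hj).2
    have hw : 0 ≤ Real.exp (-(δ / 2 * M * ((h : ℝ) - j))) * (1 + ((h : ℝ) - j)) ^ (1 + β₀) := by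
      have : (j : ℝ) ≤ h := by exact_mod_cast hjh
      have : 0 ≤ (1 + ((h : ℝ) - j)) ^ (1 + β₀) := Real.rpow_nonneg (by linarith) _
      positivity
    have e : ∑ x ∈ Γ j, Real.exp (-(δ / 2 * dist x)) * Real.exp (-(δ / 2 * M * ((h : ℝ) - j))) *
          (1 + ((h : ℝ) - j)) ^ (1 + β₀) =
        (∑ x ∈ Γ j, Real.exp (-(δ / 2 * dist x))) *
          (Real.exp (-(δ / 2 * M * ((h : ℝ) - j))) * (1 + ((h : ℝ) - j)) ^ (1 + β₀)) := by
      rw [sum_mul]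
      exact sum_congr rfl fun x _ => by ring
    rw [e]
    calc (∑ x ∈ Γ j, Real.exp (-(δ / 2 * dist x))) *
          (Real.exp (-(δ / 2 * M * ((h : ℝ) - j))) * (1 + ((h : ℝ) - j)) ^ (1 + β₀))
        ≤ (CΓ * cardΓ * G ^ (h - j)) *
          (Real.exp (-(δ / 2 * M * ((h : ℝ) - j))) * (1 + ((h : ℝ) - j)) ^ (1 + β₀)) :=
          mul_le_mul_of_nonneg_right (hcount j hj) hw
      _ = _ := by ring
  calc ∑ j ∈ Icc 1 h, ∑ x ∈ Γ j, Real.exp (-(δ / 2 * dist x)) * Real.exp (-(δ / 2 * M * ((h : ℝ) - j))) *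
          (1 + ((h : ℝ) - j)) ^ (1 + β₀)
      ≤ ∑ j ∈ Icc 1 h, (CΓ * cardΓ) * (G ^ (h - j) *
          (Real.exp (-(δ / 2 * M * ((h : ℝ) - j))) * (1 + ((h : ℝ) - j)) ^ (1 + β₀))) := sum_le_sum hstep
    _ = (CΓ * cardΓ) * ∑ j ∈ Icc 1 h, G ^ (h - j) *
          (Real.exp (-(δ / 2 * M * ((h : ℝ) - j))) * (1 + ((h : ℝ) - j)) ^ (1 + β₀)) := by rw [mul_sum]
    _ ≤ (CΓ * cardΓ) * 2 :=
        mul_le_mul_of_nonneg_left (scaleSum_le_two_of_growth hG hδM hβ₁ h) (by positivity)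
    _ = 2 * CΓ * cardΓ := by ring

/-- **(1.47) from its first line, with the multi-scale per-scale count** (p. 368 [14]): as `ineq147_of_first_count`, the
per-scale count now allowed to grow like `G^{h−j}` (`G ≧ 1`, the point density of the finer lattices `L^jη` carrying `Γ″_j`, (1.13) [IV])
and the located largeness strengthened to `δM ≧ 6 + 2log G`; `O(1) = C(1 + C′)(1 + β₀)²·2CΓ·Cγ`. PROVED. [cite: Balaban1989LargeFieldII, (1.47) p.368] -/
theorem ineq147_of_first_growing_count {T B₃ δ C Linv B₅ M alpha gk C' εk β₀ C₁ q₁g A₀ p₀g Rk CΓ cardΓ Cγ G : ℝ}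
    {N k h : ℕ} {ε : ℕ → ℝ} {Γ : ℕ → Finset α} {dist : α → ℝ}
    (hfirst : Ineq147First T B₃ δ C Linv B₅ M alpha gk C' N k h ε Γ dist)
    (hB₃ : 0 ≤ B₃) (hC : 0 ≤ C) (hLinv : 0 ≤ Linv) (hB₅ : 0 ≤ B₅) (hα : 0 ≤ alpha)
    (hgk : 0 < gk) (hgk1 : gk ≤ 1) (hC' : 0 ≤ C') (hεk : 0 ≤ εk) (hδ : 0 ≤ δ) (hβ₀ : 0 ≤ β₀)
    (hβ₁ : β₀ ≤ 1) (hN : 1 ≤ N) (hk : k = h + N) (hG : 1 ≤ G) (hδM : 6 + 2 * Real.log G ≤ δ * M)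
    (hdist : ∀ j ∈ Icc 1 h, ∀ x ∈ Γ j, M * ((h : ℝ) - j) ≤ dist x)
    (hε : ∀ j ∈ Icc 1 h, ε j ≤ (1 + β₀) ^ 2 * ((k : ℝ) - j) ^ β₀ * εk)
    (hαeq : alpha = C₁ * gk * q₁g) (hεeq : εk = gk * A₀ * p₀g) (hNW : B16Sect1Kernels.NWindowUpper N Rk)
    (hCΓ : 0 ≤ CΓ) (hcard : 0 ≤ cardΓ)
    (hcount : ∀ j ∈ Icc 1 h, ∑ x ∈ Γ j, Real.exp (-(δ / 2 * dist x)) ≤ CΓ * cardΓ * G ^ (h - j))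
    (hΓ : cardΓ ≤ Cγ * M ^ 4 * Rk ^ 5) :
    B16Sect1Statements.Ineq147 T ((C * (1 + C') * (1 + β₀) ^ 2 * (2 * CΓ)) * Cγ) A₀ C₁ B₃ B₅ M p₀g q₁g Rk
      Linv N := by
  have hS : sum147b δ M β₀ h Γ dist ≤ (2 * CΓ) * cardΓ := by
    have := sum147b_le_of_growing_count (Γ := Γ) (dist := dist) hG hδM hβ₁ hCΓ hcard hcount
    linarith
  exact ineq147_of_first hfirst hB₃ hC hLinv hB₅ hα hgk hgk1 hC' hεk hδ hβ₀ hβ₁ hN hk hdist hε hαeq hεeq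
    hNW (by positivity) hS hΓ

end

end Literature.MathematicalPhysics.QuantumFieldTheory.Balaban1983to89.B16Ineq147Chain
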